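import Mathlib
import Summits.ResolutionOfSingularities.ResolutionOfSingularities.Theorems.WildQuotientsWildQuotientResolutionS1PlanarFieldDefs
import Summits.ResolutionOfSingularities.ResolutionOfSingularities.Theorems.WildConesClassicalRegimesStubMuDropCharTwoOrdPNoether
import Literature.RingTheory.MvPowerSeries.FiniteColength

/-!
(FILE 1/2: Part I — the STEP TOOLS; split for the 400-line cap by the filer res-L1-w45c-stub-2, decls VERBATIM from res-L1-w45c-idea-1 `w1n/S1W1NOStep.lean` a13dd1fd4a17bec2)

# S1 / W1N cascade — `OStep0` (the Milnor number drops at a type-O step) and the STEP TOOLS it shares with `NStep` / `NTwoExit`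

Crux stmt-ResolutionOfSingularities-17941 (`WildQuotients.CyclicQuotientFourfolds`), S1a line `s1a-logminvertex`,
stub `stub_W1N_print`, sub-line `w1n-cascade` (idea-1 `W1N-LINE.md`, plan `OSTEP-PLAN.md`).
[OURS · L1 W4.5c] — NOT a statement of the manuscript; counted 0 post-V5.

After brick B3 (`S1W1NTransport.lean`: `forall_isSucc_of_chart1_zero`) every successor step is a chart-1
step at `c = 0`, i.e. along the toolkit's blow-up chart `B = (x, x·y) = ![X 0, X 0 * X 1]`
(`chart1_zero_eq_blow`).  This file collects the small algebra the three Milnor-number stubs share: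

* `X_zero_mul_transform` — the `g`-DEVICE: `x · (b∘B − y·(a∘B)) = (x·b − y·a)∘B`, so the second component
  of a successor is a transform of the GENUINE series `g := x·b − y·a` (order `≥ ν + 1`), to which the
  tree's `MuDropCharTwoOrdP.exists_strict_transform` / `noether_inequality` apply;
* `X_pow_cancel` — `x`-adic bookkeeping `x^s·a' = x^m·A`, `x ∤ A` ⇒ `s ≤ m ∧ a' = x^(m-s)·A`;
* `killCompl_ne_zero_iff_not_X_dvd` — `g(0,y) ≠ 0 ↔ x ∤ g`;
* `finite_quot_span_pair_X_pow_mul` — `/(P, x)` and `/(P, H)` finite ⇒ `/(P, x^k·H)` finite (the UPWARD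
  companion of the tree's `colength_X_pow_mul`, which goes downward);
* `ne_zero_of_isIsolated` — an isolated singular node has `a ≠ 0 ∧ b ≠ 0`;
* `two_le_order_iff_linearPart_eq_zero` — for a singular node, `linearPart = 0 ↔ 2 ≤ ord a ∧ 2 ≤ ord b`.
-/

-- single-problem summit: the doubled namespace component `ResolutionOfSingularities` is forced
set_option linter.dupNamespace false

noncomputable section

open MvPowerSeries IsLocalRing
open Literature.AlgebraicGeometry.Resolution
open Summit.ResolutionOfSingularities.ResolutionOfSingularities.Theorems.WildCones.MuDropCharTwoOrdP

namespace Summit.ResolutionOfSingularities.ResolutionOfSingularities.Theorems.WildQuotientResolution.S1.PlanarField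

variable {κ : Type} [Field κ]

/-! ## Chart 1 at `0` is the blow-up chart `B = (x, x y)` -/

/-- `chart1_zero_eq_blow` (W1N step tools; see the module docstring). [OURS · L1 W4.5c] -/
theorem chart1_zero_eq_blow : chart1 (0 : κ) = (![X 0, X 0 * X 1] : Fin 2 → MvPowerSeries (Fin 2) κ) := by
  funext i
  fin_cases i <;> simp [chart1]

/-- `hasSubst_chart1_zero` (W1N step tools; see the module docstring). [OURS · L1 W4.5c] -/
theorem hasSubst_chart1_zero : HasSubst (chart1 (0 : κ)) := by
  rw [chart1_zero_eq_blow]; exact PlaneGerm.hasSubst_blow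

/-- The `g`-DEVICE: `x · (b∘B − y'·(a∘B)) = (x·b − y·a)∘B`. [folklore] -/
theorem X_zero_mul_transform (a b : MvPowerSeries (Fin 2) κ) :
    X 0 * (subst (chart1 (0 : κ)) b - X 1 * subst (chart1 (0 : κ)) a) =
      subst (chart1 (0 : κ)) (X 0 * b - X 1 * a) := by
  have h := hasSubst_chart1_zero (κ := κ)
  rw [subst_sub h, subst_mul h, subst_mul h, subst_X (R := κ) h, subst_X (R := κ) h]
  simp [chart1]
  ring

/-- The second successor equation of a chart-1 step at `0`, multiplied by `x`:
`x^(s+2) · b' = (x·b − y·a)∘B`. [OURS · L1 W4.5c] -/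
theorem isSuccChart1_zero_eq (θ θ' : PlanarField κ) {s : ℕ}
    (h2 : X 0 ^ (s + 1) * θ'.b = subst (chart1 (0 : κ)) θ.b - (X 1 + C (0 : κ)) * subst (chart1 (0 : κ)) θ.a) :
    X 0 ^ (s + 2) * θ'.b = subst (chart1 (0 : κ)) (X 0 * θ.b - X 1 * θ.a) := by
  rw [map_zero, add_zero] at h2
  rw [← X_zero_mul_transform, ← h2]
  ring

/-! ## `x`-adic bookkeeping -/

/-- `X_zero_ne_zero` (W1N step tools; see the module docstring). [OURS · L1 W4.5c] -/
theorem X_zero_ne_zero : (X 0 : MvPowerSeries (Fin 2) κ) ≠ 0 := fun h => by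
  have := congrArg (coeff (Finsupp.single (0 : Fin 2) 1)) h
  rw [coeff_X, if_pos rfl, map_zero] at this
  exact one_ne_zero this

/-- `x^s·a' = x^m·A` with `x ∤ A` forces `s ≤ m` and `a' = x^(m-s)·A`. [folklore] -/
theorem X_pow_cancel {s m : ℕ} {a' A : MvPowerSeries (Fin 2) κ} (hA : ¬ (X 0 : MvPowerSeries (Fin 2) κ) ∣ A)
    (h : X 0 ^ s * a' = X 0 ^ m * A) : s ≤ m ∧ a' = X 0 ^ (m - s) * A := by
  have hx : ∀ n : ℕ, (X 0 : MvPowerSeries (Fin 2) κ) ^ n ≠ 0 := fun n => pow_ne_zero n X_zero_ne_zero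
  by_cases hsm : s ≤ m
  · refine ⟨hsm, mul_left_cancel₀ (hx s) ?_⟩
    rw [h, ← mul_assoc, ← pow_add, Nat.add_sub_cancel' hsm]
  · exfalso
    apply hA
    have hms : m ≤ s := le_of_not_ge hsm
    have h' : X 0 ^ m * (X 0 ^ (s - m) * a') = X 0 ^ m * A := by
      rw [← mul_assoc, ← pow_add, Nat.add_sub_cancel' hms, h]
    have hA' := mul_left_cancel₀ (hx m) h'
    refine ⟨X 0 ^ (s - m - 1) * a', ?_⟩
    rw [← hA', ← mul_assoc, ← pow_succ', Nat.sub_add_cancel (by omega)]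

/-! ## The `y`-axis restriction `g(0, y)` and divisibility by `x` -/

/-- `g(0, y) ≠ 0 ↔ x ∤ g`. [folklore] -/
theorem killCompl_ne_zero_iff_not_X_dvd (g : MvPowerSeries (Fin 2) κ) :
    killCompl (⟨fun _ => (1 : Fin 2), fun a b _ => Subsingleton.elim a b⟩ : Fin 1 ↪ Fin 2) g ≠ 0 ↔
      ¬ (X 0 : MvPowerSeries (Fin 2) κ) ∣ g := by
  set e : Fin 1 ↪ Fin 2 := ⟨fun _ => (1 : Fin 2), fun a b _ => Subsingleton.elim a b⟩ with he
  constructor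
  · rintro hK ⟨w, rfl⟩
    apply hK
    rw [map_mul, killCompl_X_eq_zero (fun ⟨i, hi⟩ => by simp [he] at hi), zero_mul]
  · intro hg hK
    apply hg
    have hmem : g ∈ RingHom.ker (killCompl (R := κ) e : MvPowerSeries (Fin 2) κ →+* MvPowerSeries (Fin 1) κ) := by
      rw [RingHom.mem_ker]; exact hK
    have h2 := ker_killCompl_le e range_axisEmb hmem
    rw [Set.pair_eq_singleton, Ideal.mem_span_singleton] at h2
    exact h2

/-! ## Finiteness of colengths, upward -/

/-- `finite_quot_of_maximalIdeal_pow_le'` (W1N step tools; see the module docstring). [OURS · L1 W4.5c] -/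
theorem finite_quot_of_maximalIdeal_pow_le' {I : Ideal (MvPowerSeries (Fin 2) κ)} {M : ℕ}
    (hM : maximalIdeal (MvPowerSeries (Fin 2) κ) ^ M ≤ I) :
    Module.Finite κ (MvPowerSeries (Fin 2) κ ⧸ I) := by
  haveI := Literature.RingTheory.MvPowerSeries.Jets.finite_quotient_maximalIdeal_pow (σ := Fin 2) (K := κ) M
  exact Module.Finite.of_surjective
    (Ideal.Quotient.factorₐ κ hM : (MvPowerSeries (Fin 2) κ ⧸ maximalIdeal (MvPowerSeries (Fin 2) κ) ^ M) →ₗ[κ]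
      MvPowerSeries (Fin 2) κ ⧸ I) (Ideal.Quotient.factor_surjective hM)

/-- `/(P, F)` and `/(P, H)` finite ⇒ `/(P, F·H)` finite. [folklore] -/
theorem finite_quot_span_pair_mul {P F H : MvPowerSeries (Fin 2) κ}
    (hF : Module.Finite κ (MvPowerSeries (Fin 2) κ ⧸ Ideal.span {P, F}))
    (hH : Module.Finite κ (MvPowerSeries (Fin 2) κ ⧸ Ideal.span {P, H})) :
    Module.Finite κ (MvPowerSeries (Fin 2) κ ⧸ Ideal.span {P, F * H}) := by
  obtain ⟨M, hM⟩ := Literature.RingTheory.MvPowerSeries.Jets.exists_maximalIdeal_pow_le_of_finite_quotient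
    (Ideal.span ({P, F} : Set (MvPowerSeries (Fin 2) κ)))
  obtain ⟨N, hN⟩ := Literature.RingTheory.MvPowerSeries.Jets.exists_maximalIdeal_pow_le_of_finite_quotient
    (Ideal.span ({P, H} : Set (MvPowerSeries (Fin 2) κ)))
  refine finite_quot_of_maximalIdeal_pow_le' (M := M + N) ?_
  have hP : P ∈ Ideal.span ({P, F * H} : Set (MvPowerSeries (Fin 2) κ)) := Ideal.subset_span (by simp)
  have hFH : F * H ∈ Ideal.span ({P, F * H} : Set (MvPowerSeries (Fin 2) κ)) := Ideal.subset_span (by simp)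
  calc maximalIdeal (MvPowerSeries (Fin 2) κ) ^ (M + N)
      = maximalIdeal _ ^ M * maximalIdeal _ ^ N := pow_add _ _ _
    _ ≤ Ideal.span {P, F} * Ideal.span {P, H} := Ideal.mul_mono hM hN
    _ = Ideal.span {P * P, P * H, F * P, F * H} := Ideal.span_pair_mul_span_pair _ _ _ _
    _ ≤ Ideal.span {P, F * H} := by
        rw [Ideal.span_le]
        rintro z hz
        simp only [Set.mem_insert_iff, Set.mem_singleton_iff] at hz
        rcases hz with rfl | rfl | rfl | rfl
        · exact Ideal.mul_mem_right _ _ hP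
        · exact Ideal.mul_mem_right _ _ hP
        · exact Ideal.mul_mem_left _ _ hP
        · exact hFH

/-- `/(P, x)` and `/(P, H)` finite ⇒ `/(P, x^k·H)` finite (upward companion of `colength_X_pow_mul`). [folklore] -/
theorem finite_quot_span_pair_X_pow_mul {P H : MvPowerSeries (Fin 2) κ} (k : ℕ)
    (hx : Module.Finite κ (MvPowerSeries (Fin 2) κ ⧸ Ideal.span {P, (X 0 : MvPowerSeries (Fin 2) κ)}))
    (hH : Module.Finite κ (MvPowerSeries (Fin 2) κ ⧸ Ideal.span {P, H})) :
    Module.Finite κ (MvPowerSeries (Fin 2) κ ⧸ Ideal.span {P, (X 0 : MvPowerSeries (Fin 2) κ) ^ k * H}) := by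
  induction k with
  | zero => rw [pow_zero, one_mul]; exact hH
  | succ k ih => rw [pow_succ', mul_assoc]; exact finite_quot_span_pair_mul hx ih

/-! ## Isolated singular nodes -/

/-- `mem_maximalIdeal_of_constantCoeff_eq_zero` (W1N step tools; see the module docstring). [OURS · L1 W4.5c] -/
theorem mem_maximalIdeal_of_constantCoeff_eq_zero {f : MvPowerSeries (Fin 2) κ} (hf : constantCoeff f = 0) :
    f ∈ maximalIdeal (MvPowerSeries (Fin 2) κ) := by
  rw [IsLocalRing.mem_maximalIdeal, mem_nonunits_iff, isUnit_iff_constantCoeff, hf]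
  exact not_isUnit_zero

/-- An isolated singular node has both components non-zero (Krull). [folklore] -/
theorem ne_zero_of_isIsolated (θ : PlanarField κ) (hiso : θ.IsIsolated) (hsing : θ.IsSingular) :
    θ.a ≠ 0 ∧ θ.b ≠ 0 := by
  obtain ⟨ha0, hb0⟩ := hsing
  have key : ∀ f g : MvPowerSeries (Fin 2) κ, constantCoeff g = 0 →
      ¬ Module.Finite κ (MvPowerSeries (Fin 2) κ ⧸ Ideal.span ({0, g} : Set (MvPowerSeries (Fin 2) κ))) := by
    intro f g hg
    rw [Ideal.span_insert_zero, ← Finset.coe_singleton]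
    refine not_finite_quot_span {g} ?_ (by simp)
    rw [Finset.coe_singleton, Set.singleton_subset_iff]
    exact mem_maximalIdeal_of_constantCoeff_eq_zero hg
  constructor
  · intro ha
    have h := hiso
    unfold IsIsolated at h
    rw [ha] at h
    exact key θ.b θ.b hb0 h
  · intro hb
    have h := hiso
    unfold IsIsolated at h
    rw [hb, Ideal.span_pair_comm] at h
    exact key θ.a θ.a ha0 h

/-- For a singular node, `linearPart = 0 ↔` both components have order `≥ 2`. [OURS · L1 W4.5c] -/
theorem linearPart_eq_zero_iff_two_le_order (θ : PlanarField κ) (hsing : θ.IsSingular) :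
    θ.linearPart = 0 ↔ 2 ≤ θ.a.order ∧ 2 ≤ θ.b.order := by
  obtain ⟨ha0, hb0⟩ := hsing
  rw [FormalCoordChange.two_le_order_iff, FormalCoordChange.two_le_order_iff]
  constructor
  · intro hL
    refine ⟨⟨ha0, fun i => ?_⟩, ⟨hb0, fun i => ?_⟩⟩
    · have := congrFun (congrFun hL 0) i
      simpa [linearPart] using this
    · have := congrFun (congrFun hL 1) i
      simpa [linearPart] using this
  · rintro ⟨⟨-, ha⟩, ⟨-, hb⟩⟩
    ext i j
    fin_cases i
    · simpa [linearPart] using ha j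
    · simpa [linearPart] using hb j


end Summit.ResolutionOfSingularities.ResolutionOfSingularities.Theorems.WildQuotientResolution.S1.PlanarField

end
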